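import Summits.ResolutionOfSingularities.ResolutionOfSingularities.Theorems.FrobeniusClosingSteerBetaPreparedTransferX
import Summits.ResolutionOfSingularities.ResolutionOfSingularities.Theorems.FrobeniusClosingSteerBetaHatLawWords
import HarnessLib

/-!
# Crux `Steer` (stmt-ResolutionOfSingularities-16345), chain W4.1, β-LEAF, K-β2♭ part (II-X): the tree word
# `BetaHat.PreparedTransferXHat` (C′, `c = 0`) HOLDS (def-free)

OURS (campaign `res-hironaka`, rung L ★L-G4, slot W4.1; statements about the route's own objects; they replace the
role of no printed item and are NOT statements of the manuscript under review [claim: Hironaka2017, status: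
under-review]; AI review is weaker than expert review). Seat res-D-pv-003 (gen 7), K-β2♭ kernel owner (res-L0-w41-plan-1
RULINGS 143/150 (2)/181b/185d).

`preparedTransferXHat_holds : PreparedTransferXHat` — the β-leaf binder `hIIx` (word of record: res-D-pv-035's
`…BetaHatLawWords` p553853 over `…BetaHatStageWords` p552756, R-J4a) is a λ-wrapper over `BetaNewton.preparedTransferX`
(`…BetaPreparedTransferX`): destructure `IsHatRing`, `IsArithStage` (only `a ≤ 1` of the square-free clause is used), `IsXChartHat` at
`c = 0` (the polynomial clause gives `κ → κ₁` onto, `surjective_of_xChart_zero`; `σ₁ 0 = 0` turns `φ y = φ x · (σ₁ 0 + v₁)` into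
`φ y = φ x · v₁`) and `IsFacePreparedTwAt`, and repackage: the middle conjunct of the conclusion is the body of
`IsPreparedTwAt u₁ (φ x) v₁ z₁ w₁ d (δ − 1) γ f₁` verbatim.

[cite: CossartJannsenSaito2020, Lemma 12.1] No Theses file is imported; nothing here is a route item or a registration.
-/

noncomputable section

-- `Summit.<S>.<S>.…` duplicates the summit name by design (single-problem summit).
set_option linter.dupNamespace false

namespace Summit.ResolutionOfSingularities.ResolutionOfSingularities.Theorems.SwitchingDichotomy.BetaHat

open Summit.ResolutionOfSingularities.ResolutionOfSingularities.Theorems.SwitchingDichotomy.BetaPolygon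
open Summit.ResolutionOfSingularities.ResolutionOfSingularities.Theorems.SwitchingDichotomy.BetaNewton

/-- **K-β2♭ (II-X) C′ holds**: `PreparedTransferXHat` (β-leaf of record v18.4-J4, square-free twist, `c = 0`) — CJS Lemma 12.1 (4)
modulo `u`-squares along the `x`-chart letter at the origin — by `BetaNewton.preparedTransferX`. [cite: CossartJannsenSaito2020, Lemma 12.1] -/
theorem preparedTransferXHat_holds : PreparedTransferXHat := by
  intro S S₁ _ _ _ _ _ _ φ σ σ₁ x y z w u f v₁ z₁ w₁ u₁ f₁ d k α₀ δ γ hS hS₁ _ h3 hA hX hrad hA₁ hAl hprep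
  obtain ⟨-, hreg, -, hdim, hperf⟩ := hS
  obtain ⟨-, hreg₁, -, hdim₁, -⟩ := hS₁
  obtain ⟨hspan, ⟨a, b, ha, -, hu⟩, hcone⟩ := hA
  obtain ⟨-, ⟨a₁, b₁, -, -, hu₁⟩, hcone₁⟩ := hA₁
  obtain ⟨-, -, -, hpoly, hspan₁, hy, hz, hw⟩ := hX
  obtain ⟨hγ, hDG, hFG, -, hnd⟩ := hprep
  have hy' : φ y = φ x * v₁ := by simpa using hy
  exact preparedTransferX hreg hdim hperf hreg₁ hdim₁ φ σ (surjective_of_xChart_zero φ σ hpoly) (by omega) hspan hu ha hcone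
    hspan₁ hu₁ hcone₁ hy' hz hw hrad hAl hγ hDG hFG (fun q h => hnd (Or.inl ⟨q, h⟩))
    (fun a b hab c₁ c₂ q h => hnd (Or.inr ⟨a, b, hab, c₁, c₂, q, h⟩))

end Summit.ResolutionOfSingularities.ResolutionOfSingularities.Theorems.SwitchingDichotomy.BetaHat

end
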